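import Mathlib
import Summits.NavierStokesRegularity.NavierStokesRegularity.Theorems.ThreadingFluxHorizonTowerDefs
import Summits.NavierStokesRegularity.NavierStokesRegularity.Theorems.ThreadingFluxHorizonTowerFiniteTowerBridge
import Summits.NavierStokesRegularity.NavierStokesRegularity.Theorems.ThreadingFluxHorizonTowerZonalForm
import HarnessLib

/-!
# Crux `PoloidalLiouville` (stmt-NavierStokesRegularity-1222), crux idea «horizon-threading-tower» (ns-idea-15):
# FINITE-TOWER TOOLKIT — the antipodal parity split of the order-one identity, and brackets with zonal shells

Support file (`--supports stmt-NavierStokesRegularity-1222`, helper; cell `ns-wall-extremal`, width hand ns-wall-eng-3 g3; 0 kit;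
director key 04:06:45Z (a)-toolkit).  Tools for «finite towers at order one» (≥ 3 shells OPEN; two shells = p691920):

* `gradient_antipodal` — for `H` homogeneous of degree `k` under all real dilations, `∇H(−x) = (−1)^{k+1} ∇H(x)`;
  `bracket_antipodal` — `⟪−x, ∇H_j(−x) × ∇H_k(−x)⟫ = (−1)^{j+k+1} ⟪x, ∇H_j(x) × ∇H_k(x)⟫`.
* ★ `finiteTower_parity_split` — if the finite tower `Σ_{l∈K} U_{H_l}` passes ORDER ONE (`𝔏₁ ≡ 0` off the centre), then the
  weighted bracket sum of `horizonL1_finiteTower_antisym` vanishes SEPARATELY over the pairs with `j + k` even and over the pairs with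
  `j + k` odd (the antipodal map flips exactly one class; the weights depend on `‖x‖` only).
* `inner_cross_of_orthogonal_axis` — the vector identity behind «brackets with a shell zonal about `a` are multiples of the dipole
  bracket»: `|a × x|² ⟪x, g × v⟫ = (‖x‖²⟪v,a⟫ − ⟪a,x⟫⟪v,x⟫) ⟪x, g × a⟫ + ⟪a × x, v⟫ (⟪a,x⟫⟪g,x⟫ − ‖x‖²⟪g,a⟫)` (all vectors), hence
  `bracket_with_zonal`: if `⟪a × x, ∇Z(x)⟫ = 0` then `|a × x|² ⟪x, ∇F(x) × ∇Z(x)⟫ = (‖x‖²⟪∇Z(x),a⟫ − ⟪a,x⟫⟪∇Z(x),x⟫) ⟪x, ∇F(x) × a⟫`,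
  and `bracket_of_coaxial_zonal`: two shells zonal about the same axis Poisson-commute (off the axis, hence everywhere by continuity
  is left to the user; the pointwise statement carries the factor `|a × x|²`).

HONEST LABEL: elementary tools about one crux idea's typed objects; no sketch Prop is closed; `HorizonTowerZonality`,
`PoloidalLiouville` (1222) OPEN; NS regularity NOT proved.
-/

-- the summit and its single sub-problem share the name (CONVENTIONS §1)
set_option linter.dupNamespace false

noncomputable section

namespace Summit.NavierStokesRegularity.NavierStokesRegularity.Theorems.PoloidalLiouville.HorizonTower

open Set Function Filter Topology Metric
open scoped Topology RealInnerProductSpace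
open Literature.Analysis.FluidPDE
open Literature.Geometry.DiscreteGeometry (inner_fin3 norm_sq_fin3)

section Antipodal

variable {H : E3 → ℝ} {k : ℕ}

/-- A function homogeneous of degree `k` under ALL real dilations is even/odd: `H(−x) = (−1)^k H(x)`. -/
theorem apply_neg_of_homogeneous (hhom : ∀ (c : ℝ) (y : E3), H (c • y) = c ^ k * H y) (x : E3) :
    H (-x) = (-1 : ℝ) ^ k * H x := by
  rw [← hhom (-1) x, neg_one_smul]

/-- **Antipodal law of the gradient**: `∇H(−x) = (−1)^{k+1} ∇H(x)` for `H` differentiable and homogeneous of degree `k`. -/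
theorem gradient_antipodal (hH : Differentiable ℝ H) (hhom : ∀ (c : ℝ) (y : E3), H (c • y) = c ^ k * H y) (x : E3) :
    gradient H (-x) = ((-1 : ℝ) ^ (k + 1)) • gradient H x := by
  have hfun : (fun y : E3 => H (-y)) = fun y => (-1 : ℝ) ^ k * H y := funext fun y => apply_neg_of_homogeneous hhom y
  -- differentiate both sides at `x`
  have h1 : fderiv ℝ (fun y : E3 => H (-y)) x = (fderiv ℝ H (-x)).comp (-(ContinuousLinearMap.id ℝ E3)) := by
    have hneg : HasFDerivAt (fun y : E3 => -y) (-(ContinuousLinearMap.id ℝ E3)) x := (hasFDerivAt_id x).neg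
    exact ((hH (-x)).hasFDerivAt.comp x hneg).fderiv
  have h2 : fderiv ℝ (fun y : E3 => H (-y)) x = ((-1 : ℝ) ^ k) • fderiv ℝ H x := by
    rw [hfun, fderiv_const_mul (hH x)]
  apply ext_inner_right ℝ
  intro v
  rw [real_inner_smul_left, Literature.Analysis.FluidPDE.inner_gradient_left, Literature.Analysis.FluidPDE.inner_gradient_left]
  have h3 := congrArg (fun L : E3 →L[ℝ] ℝ => L v) (h1.symm.trans h2)
  simp only [ContinuousLinearMap.comp_apply, FunLike.coe_neg, FunLike.coe_smul, Pi.neg_apply,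
    Pi.smul_apply, ContinuousLinearMap.coe_id', id, smul_eq_mul, map_neg] at h3
  -- `h3 : -(fderiv H (-x) v) = (-1)^k * fderiv H x v`
  rw [pow_succ]
  linarith [h3]

/-- **Antipodal law of the bracket**: `⟪−x, ∇H_j(−x) × ∇H_k(−x)⟫ = (−1)^{j+k+1} ⟪x, ∇H_j(x) × ∇H_k(x)⟫`. -/
theorem bracket_antipodal {Hj Hk : E3 → ℝ} {j k : ℕ} (hj : Differentiable ℝ Hj) (hk : Differentiable ℝ Hk)
    (hhomj : ∀ (c : ℝ) (y : E3), Hj (c • y) = c ^ j * Hj y) (hhomk : ∀ (c : ℝ) (y : E3), Hk (c • y) = c ^ k * Hk y)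
    (x : E3) :
    ⟪-x, cross (gradient Hj (-x)) (gradient Hk (-x))⟫ = (-1 : ℝ) ^ (j + k + 1) * ⟪x, cross (gradient Hj x) (gradient Hk x)⟫ := by
  rw [gradient_antipodal hj hhomj, gradient_antipodal hk hhomk]
  obtain ⟨p0, p1, p2⟩ := cross_fin3 (((-1 : ℝ) ^ (j + 1)) • gradient Hj x) (((-1 : ℝ) ^ (k + 1)) • gradient Hk x)
  obtain ⟨q0, q1, q2⟩ := cross_fin3 (gradient Hj x) (gradient Hk x)
  rw [inner_fin3, inner_fin3, p0, p1, p2, q0, q1, q2]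
  simp only [PiLp.neg_apply, PiLp.smul_apply, smul_eq_mul]
  ring

end Antipodal

section ParitySplit

variable (K : Finset ℕ) (H : ℕ → E3 → ℝ)

/-- ★ **PARITY SPLIT of the order-one identity of a finite tower.**  If the finite scale-free tower `Σ_{l∈K} U_{H_l}` passes
order one off the centre, then for every `x ≠ 0` the weighted bracket sum over the pairs `(j,k)` with `j + k` EVEN and the one
over the pairs with `j + k` ODD both vanish. -/
theorem finiteTower_parity_split (hK : ∀ l ∈ K, 1 ≤ l) (hH : ∀ l ∈ K, ContDiff ℝ (⊤ : ℕ∞) (H l))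
    (hhom : ∀ l ∈ K, ∀ (c : ℝ) (y : E3), H l (c • y) = c ^ l * H l y)
    (hharm : ∀ l ∈ K, ∀ y, Laplacian.laplacian (H l) y = 0)
    (hL1 : ∀ x : E3, x ≠ 0 → horizonL1 (fun z => ∑ l ∈ K, horizonProfile l (H l) 0 z) 0 x = 0) {x : E3} (hx : x ≠ 0) :
    (∑ j ∈ K, ∑ k ∈ K, (if Even (j + k) then
        (((j * (j + 1) : ℝ)) - (k * (k + 1) : ℝ)) * (‖x‖ ^ 2) ^ (-(j : ℝ) / 2) * (‖x‖ ^ 2) ^ (-(k : ℝ) / 2)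
          * ⟪x, cross (gradient (H j) x) (gradient (H k) x)⟫ else 0) = 0) ∧
    (∑ j ∈ K, ∑ k ∈ K, (if Even (j + k) then 0 else
        (((j * (j + 1) : ℝ)) - (k * (k + 1) : ℝ)) * (‖x‖ ^ 2) ^ (-(j : ℝ) / 2) * (‖x‖ ^ 2) ^ (-(k : ℝ) / 2)
          * ⟪x, cross (gradient (H j) x) (gradient (H k) x)⟫) = 0) := by
  classical
  -- the identity at `x` and at `−x`
  have hnx : -x ≠ 0 := neg_ne_zero.mpr hx
  have hr : 0 < ‖x‖ := norm_pos_iff.mpr hx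
  set w : ℕ → ℕ → ℝ := fun j k =>
    (((j * (j + 1) : ℝ)) - (k * (k + 1) : ℝ)) * (‖x‖ ^ 2) ^ (-(j : ℝ) / 2) * (‖x‖ ^ 2) ^ (-(k : ℝ) / 2) with hw
  set B : ℕ → ℕ → ℝ := fun j k => ⟪x, cross (gradient (H j) x) (gradient (H k) x)⟫ with hB
  have hS : ∑ j ∈ K, ∑ k ∈ K, w j k * B j k = 0 := by
    have h := horizonL1_finiteTower_antisym K H hK hH hhom hharm hx
    rw [hL1 x hx] at h
    have h' : ‖x‖ * ∑ j ∈ K, ∑ k ∈ K, w j k * B j k = 0 := by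
      rw [hw, hB]
      simp only
      linarith
    exact (mul_eq_zero.1 h').resolve_left hr.ne'
  have hS' : ∑ j ∈ K, ∑ k ∈ K, w j k * ((-1 : ℝ) ^ (j + k + 1) * B j k) = 0 := by
    have h := horizonL1_finiteTower_antisym K H hK hH hhom hharm hnx
    rw [hL1 (-x) hnx, norm_neg] at h
    have hd : ∀ l ∈ K, Differentiable ℝ (H l) := fun l hl => (hH l hl).differentiable (by simp)
    have hterm : ∀ j ∈ K, ∀ k ∈ K,
        ⟪-x, cross (gradient (H j) (-x)) (gradient (H k) (-x))⟫ = (-1 : ℝ) ^ (j + k + 1) * B j k := fun j hj k hk =>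
      bracket_antipodal (hd j hj) (hd k hk) (hhom j hj) (hhom k hk) x
    have hsum : ∑ j ∈ K, ∑ k ∈ K,
        (((j * (j + 1) : ℝ)) - (k * (k + 1) : ℝ)) * (‖x‖ ^ 2) ^ (-(j : ℝ) / 2) * (‖x‖ ^ 2) ^ (-(k : ℝ) / 2)
          * ⟪-x, cross (gradient (H j) (-x)) (gradient (H k) (-x))⟫
        = ∑ j ∈ K, ∑ k ∈ K, w j k * ((-1 : ℝ) ^ (j + k + 1) * B j k) :=
      Finset.sum_congr rfl fun j hj => Finset.sum_congr rfl fun k hk => by rw [hterm j hj k hk]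
    have h' : ‖x‖ * ∑ j ∈ K, ∑ k ∈ K, w j k * ((-1 : ℝ) ^ (j + k + 1) * B j k) = 0 := by
      rw [← hsum]; linarith
    exact (mul_eq_zero.1 h').resolve_left hr.ne'
  -- even / odd bookkeeping: `(−1)^{j+k+1} = −1` on even pairs, `+1` on odd pairs
  have hE : ∑ j ∈ K, ∑ k ∈ K, (if Even (j + k) then w j k * B j k else 0)
      = (1 / 2 : ℝ) * (∑ j ∈ K, ∑ k ∈ K, w j k * B j k - ∑ j ∈ K, ∑ k ∈ K, w j k * ((-1 : ℝ) ^ (j + k + 1) * B j k)) := by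
    rw [← Finset.sum_sub_distrib, Finset.mul_sum]
    refine Finset.sum_congr rfl fun j _ => ?_
    rw [← Finset.sum_sub_distrib, Finset.mul_sum]
    refine Finset.sum_congr rfl fun k _ => ?_
    split_ifs with hjk
    · rw [pow_succ, Even.neg_one_pow hjk]; ring
    · rw [pow_succ, Odd.neg_one_pow (Nat.not_even_iff_odd.mp hjk)]; ring
  have hO : ∑ j ∈ K, ∑ k ∈ K, (if Even (j + k) then 0 else w j k * B j k)
      = (1 / 2 : ℝ) * (∑ j ∈ K, ∑ k ∈ K, w j k * B j k + ∑ j ∈ K, ∑ k ∈ K, w j k * ((-1 : ℝ) ^ (j + k + 1) * B j k)) := by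
    rw [← Finset.sum_add_distrib, Finset.mul_sum]
    refine Finset.sum_congr rfl fun j _ => ?_
    rw [← Finset.sum_add_distrib, Finset.mul_sum]
    refine Finset.sum_congr rfl fun k _ => ?_
    split_ifs with hjk
    · rw [pow_succ, Even.neg_one_pow hjk]; ring
    · rw [pow_succ, Odd.neg_one_pow (Nat.not_even_iff_odd.mp hjk)]; ring
  refine ⟨?_, ?_⟩
  · have : ∑ j ∈ K, ∑ k ∈ K, (if Even (j + k) then w j k * B j k else 0) = 0 := by rw [hE, hS, hS']; ring
    simpa only [hw, hB] using this
  · have : ∑ j ∈ K, ∑ k ∈ K, (if Even (j + k) then 0 else w j k * B j k) = 0 := by rw [hO, hS, hS']; ring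
    simpa only [hw, hB] using this

end ParitySplit

section ZonalBracket

/-- **The vector identity behind brackets with zonal shells** (all vectors, no hypothesis):
`|a × x|² ⟪x, g × v⟫ = (‖x‖²⟪v,a⟫ − ⟪a,x⟫⟪v,x⟫) ⟪x, g × a⟫ + ⟪a × x, v⟫ (⟪a,x⟫⟪g,x⟫ − ‖x‖²⟪g,a⟫)`. -/
theorem inner_cross_of_orthogonal_axis (a x g v : E3) :
    ‖cross a x‖ ^ 2 * ⟪x, cross g v⟫
      = (‖x‖ ^ 2 * ⟪v, a⟫ - ⟪a, x⟫ * ⟪v, x⟫) * ⟪x, cross g a⟫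
        + ⟪cross a x, v⟫ * (⟪a, x⟫ * ⟪g, x⟫ - ‖x‖ ^ 2 * ⟪g, a⟫) := by
  obtain ⟨c0, c1, c2⟩ := cross_fin3 a x
  obtain ⟨d0, d1, d2⟩ := cross_fin3 g v
  obtain ⟨e0, e1, e2⟩ := cross_fin3 g a
  rw [norm_sq_fin3, norm_sq_fin3, inner_fin3, inner_fin3, inner_fin3, inner_fin3, inner_fin3, inner_fin3, inner_fin3,
    inner_fin3, c0, c1, c2, d0, d1, d2, e0, e1, e2]
  ring

/-- ★ **Brackets with a shell zonal about `a` are multiples of the dipole bracket** (pointwise): if `⟪a × x, ∇Z(x)⟫ = 0` then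
`|a × x|² ⟪x, ∇F(x) × ∇Z(x)⟫ = (‖x‖²⟪∇Z(x),a⟫ − ⟪a,x⟫⟪∇Z(x),x⟫) · ⟪x, ∇F(x) × a⟫`. -/
theorem bracket_with_zonal {F Z : E3 → ℝ} {a x : E3} (hZ : ⟪cross a x, gradient Z x⟫ = 0) :
    ‖cross a x‖ ^ 2 * ⟪x, cross (gradient F x) (gradient Z x)⟫
      = (‖x‖ ^ 2 * ⟪gradient Z x, a⟫ - ⟪a, x⟫ * ⟪gradient Z x, x⟫) * ⟪x, cross (gradient F x) a⟫ := by
  rw [inner_cross_of_orthogonal_axis, hZ, zero_mul, add_zero]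

/-- **Coaxial zonal shells Poisson-commute** (pointwise, off the axis the factor `|a × x|²` can be cancelled):
`⟪a × x, ∇Y(x)⟫ = 0 = ⟪a × x, ∇Z(x)⟫ ⇒ |a × x|² ⟪x, ∇Y(x) × ∇Z(x)⟫ = 0`. -/
theorem bracket_of_coaxial_zonal {Y Z : E3 → ℝ} {a x : E3} (hY : ⟪cross a x, gradient Y x⟫ = 0)
    (hZ : ⟪cross a x, gradient Z x⟫ = 0) :
    ‖cross a x‖ ^ 2 * ⟪x, cross (gradient Y x) (gradient Z x)⟫ = 0 := by
  rw [bracket_with_zonal hZ]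
  -- `⟪x, ∇Y × a⟫ = −⟪a × x, ∇Y⟫ = 0`
  have h : ⟪x, cross (gradient Y x) a⟫ = ⟪cross a x, gradient Y x⟫ := by
    obtain ⟨c0, c1, c2⟩ := cross_fin3 (gradient Y x) a
    obtain ⟨d0, d1, d2⟩ := cross_fin3 a x
    rw [inner_fin3, inner_fin3, c0, c1, c2, d0, d1, d2]; ring
  rw [h, hY, mul_zero]

end ZonalBracket

end Summit.NavierStokesRegularity.NavierStokesRegularity.Theorems.PoloidalLiouville.HorizonTower

end
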